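import Summits.NavierStokesRegularity.NavierStokesRegularity.Theses.RellichScar
import Summits.NavierStokesRegularity.NavierStokesRegularity.Theorems.RellichScarAxisymmetricApexFatal
import Summits.NavierStokesRegularity.NavierStokesRegularity.Theorems.RellichScarScarRigidityApexMild
import Summits.NavierStokesRegularity.NavierStokesRegularity.Theorems.RellichScarSymmetricScarExistsScarDefectLimit
import Summits.NavierStokesRegularity.NavierStokesRegularity.Theorems.RellichScarSymmetricScarExistsSmallConstant
import Summits.NavierStokesRegularity.NavierStokesRegularity.Theorems.RellichScarSymmetricScarExistsIrrationalStabiliser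
import Literature.Analysis.FluidPDE.TypeIAncientMild
import Literature.Analysis.FluidPDE.AxisymHouLiVariables

/-!
# Crux `SymmetricScarExists` (stmt-NavierStokesRegularity-11718), line `rdss-screw-split` —
# stub `stub_irrationalRotationApexFatal` (AUX-1): a singular apex profile is not a.e. invariant
# under a rotation by an irrational angle

Helper file of the line lead (`--supports stmt-NavierStokesRegularity-11718`; theorems only, no
definitions, no named facts).  Let `(u, p)` be a suitable weak solution of Navier–Stokes on the
backward slab `(−∞, 0) × ℝ³` with a weak gradient `G`, `𝐈 < ∞`, the apex bound
`‖u(t, x)‖ ≤ C/(‖x‖ + √(−t))`, singular at the space–time origin, and a.e. invariant on the slab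
under the rotation-conjugation `(t, x) ↦ R_θ u(t, R_{−θ} x)` about the `x₃`-axis for ONE angle `θ`
with `θ/2π` irrational.  Then `False`:

* `C ≤ 0`: the apex bound forces `u = 0` on `t < 0`, so the origin is not singular.
* `C > 0`: `u` is a.e. a Type-I ancient mild field `V`, continuous on the open slab (KNSS 2009,
  `stub_apexMildRepresentative`).  The a.e. invariance transports to `V` (`conjZ_ae_eq_slab`) and,
  both sides being continuous, holds POINTWISE on the open slab (`Measure.eqOn_open_of_ae_eq`).
  The stabiliser `{φ | ∀ t < 0, ∀ x, R_φ V(t, R_{−φ} x) = V(t, x)}` is an additive subgroup of `ℝ`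
  (the conjugations form a one-parameter group), closed (continuity of `(φ, x) ↦ R_φ x` and of
  `V(t, ·)`), and contains `2π` and `θ`; by `AddSubgroup.dense_or_cyclic` it is all of `ℝ`
  (`forall_of_irrational_angle_stabiliser`).  Going back to `u` a.e., `u` is a.e. invariant under
  EVERY rotation about the axis, which the landed item `AxisymmetricApexFatal`
  (`rellichScar_axisymmetricApexFatal_proof`, Seregin–Šverák 2009 Thm 3.1) excludes.

## References

* G. Seregin, V. Šverák, Comm. PDE 34 (2009), 171–201, Thm 3.1 (= Thm 1.1). [SereginSverak2009]
* G. Koch, N. Nadirashvili, G. Seregin, V. Šverák, Acta Math. 203 (2009), §4 Prop. 4.1. [KNSS2009]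
* N. Bourbaki, *General Topology*, Ch. V §1 (closed subgroups of `ℝ`). [folklore]
-/

noncomputable section

open MeasureTheory Set Function Filter Topology TopologicalSpace Metric
open scoped NNReal ENNReal

namespace Summit.NavierStokesRegularity.NavierStokesRegularity.Theorems.SymmetricScarExists.RdssSplit.NearIdentity

set_option linter.dupNamespace false

open Literature.Analysis.FluidPDE
open Summit.NavierStokesRegularity.NavierStokesRegularity.Theses.RellichScar
open Summit.NavierStokesRegularity.NavierStokesRegularity.Theorems.SymmetricScarExists.Negative
open Summit.NavierStokesRegularity.NavierStokesRegularity.Theorems.SymmetricScarExists.ScarWindow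
  (conjZ_ae_eq_slab continuousOn_uncurry_conjZ not_isBackwardSingularPoint_of_ae_zero_slab
    eq_zero_of_hasTypeIDecay_nonpos)
open Summit.NavierStokesRegularity.NavierStokesRegularity.Theorems.RellichScarScarRigidity
  (stub_apexMildRepresentative)
open Summit.NavierStokesRegularity.NavierStokesRegularity.Theorems
  (rellichScar_axisymmetricApexFatal_proof continuous_rotZ_uncurry)

/-! ## The stabiliser of a field under the rotation-conjugations is a closed subgroup -/

/-- The conjugation by the zero angle fixes every field on `t < 0`. [folklore] -/
theorem irrRotApex_stab_zero (V : ℝ → EuclideanSpace ℝ (Fin 3) → EuclideanSpace ℝ (Fin 3)) :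
    ∀ t : ℝ, t < 0 → ∀ x : EuclideanSpace ℝ (Fin 3), conjZ 0 V t x = V t x := by
  intro t _ x
  rw [conjZ_zero]

/-- The stabiliser is closed under addition of angles (`conjZ φ ∘ conjZ ψ = conjZ (φ + ψ)`).
[folklore] -/
theorem irrRotApex_stab_add (V : ℝ → EuclideanSpace ℝ (Fin 3) → EuclideanSpace ℝ (Fin 3))
    (φ ψ : ℝ) (hφ : ∀ t : ℝ, t < 0 → ∀ x : EuclideanSpace ℝ (Fin 3), conjZ φ V t x = V t x)
    (hψ : ∀ t : ℝ, t < 0 → ∀ x : EuclideanSpace ℝ (Fin 3), conjZ ψ V t x = V t x) :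
    ∀ t : ℝ, t < 0 → ∀ x : EuclideanSpace ℝ (Fin 3), conjZ (φ + ψ) V t x = V t x := by
  intro t ht x
  rw [← conjZ_conjZ]
  show rotZ φ (conjZ ψ V t (rotZ (-φ) x)) = V t x
  rw [hψ t ht (rotZ (-φ) x)]
  exact hφ t ht x

/-- The stabiliser is closed under negation of angles. [folklore] -/
theorem irrRotApex_stab_neg (V : ℝ → EuclideanSpace ℝ (Fin 3) → EuclideanSpace ℝ (Fin 3))
    (φ : ℝ) (hφ : ∀ t : ℝ, t < 0 → ∀ x : EuclideanSpace ℝ (Fin 3), conjZ φ V t x = V t x) :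
    ∀ t : ℝ, t < 0 → ∀ x : EuclideanSpace ℝ (Fin 3), conjZ (-φ) V t x = V t x := by
  intro t ht x
  have h := hφ t ht (rotZ φ x)
  change rotZ φ (V t (rotZ (-φ) (rotZ φ x))) = V t (rotZ φ x) at h
  rw [rotZ_neg_apply_rotZ] at h
  show rotZ (-φ) (V t (rotZ (- -φ) x)) = V t x
  rw [neg_neg, ← h, rotZ_neg_apply_rotZ]

/-- A full turn is in the stabiliser: `R_{2π} = R_{−2π} = 1`. [folklore] -/
theorem irrRotApex_stab_two_pi (V : ℝ → EuclideanSpace ℝ (Fin 3) → EuclideanSpace ℝ (Fin 3)) :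
    ∀ t : ℝ, t < 0 → ∀ x : EuclideanSpace ℝ (Fin 3), conjZ (2 * Real.pi) V t x = V t x := by
  intro t _ x
  show rotZ (2 * Real.pi) (V t (rotZ (-(2 * Real.pi)) x)) = V t x
  rw [rotZ_neg_two_pi, rotZ_two_pi']

/-- For a fixed field value, the conjugated value `φ ↦ R_φ V(t, R_{−φ} x)` depends continuously on
the angle when the slice `V(t, ·)` is continuous. [folklore] -/
theorem irrRotApex_continuous_conjZ_angle
    {V : ℝ → EuclideanSpace ℝ (Fin 3) → EuclideanSpace ℝ (Fin 3)} {t : ℝ}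
    (hVt : Continuous (V t)) (x : EuclideanSpace ℝ (Fin 3)) :
    Continuous fun φ : ℝ => conjZ φ V t x := by
  have h1 : Continuous fun φ : ℝ => rotZ (-φ) x :=
    continuous_rotZ_uncurry.comp (f := fun φ : ℝ => ((-φ, x) : ℝ × EuclideanSpace ℝ (Fin 3)))
      (continuous_neg.prodMk continuous_const)
  have h2 : Continuous fun φ : ℝ => V t (rotZ (-φ) x) := hVt.comp h1
  show Continuous fun φ : ℝ => rotZ φ (V t (rotZ (-φ) x))
  exact continuous_rotZ_uncurry.comp
    (f := fun φ : ℝ => ((φ, V t (rotZ (-φ) x)) : ℝ × EuclideanSpace ℝ (Fin 3)))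
    (continuous_id.prodMk h2)

/-- **The stabiliser of a field continuous on the open slab is closed**: it is the intersection
over `t < 0` and `x` of the zero sets of the continuous maps `φ ↦ R_φ V(t, R_{−φ} x) − V(t, x)`.
[folklore] -/
theorem irrRotApex_stab_isClosed
    {V : ℝ → EuclideanSpace ℝ (Fin 3) → EuclideanSpace ℝ (Fin 3)}
    (hV : ContinuousOn (uncurry V) (Iio (0 : ℝ) ×ˢ (univ : Set (EuclideanSpace ℝ (Fin 3))))) :
    IsClosed {φ : ℝ | ∀ t : ℝ, t < 0 → ∀ x : EuclideanSpace ℝ (Fin 3), conjZ φ V t x = V t x} := by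
  have hset : {φ : ℝ | ∀ t : ℝ, t < 0 → ∀ x : EuclideanSpace ℝ (Fin 3), conjZ φ V t x = V t x}
      = ⋂ t : ℝ, ⋂ (_ : t < 0), ⋂ x : EuclideanSpace ℝ (Fin 3),
          {φ : ℝ | conjZ φ V t x = V t x} := by
    ext φ
    simp only [mem_setOf_eq, mem_iInter]
  rw [hset]
  refine isClosed_iInter fun t => isClosed_iInter fun ht => isClosed_iInter fun x => ?_
  have hVt : Continuous (V t) := by
    have hmaps : ∀ y : EuclideanSpace ℝ (Fin 3), ((t, y) : ℝ × EuclideanSpace ℝ (Fin 3))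
        ∈ Iio (0 : ℝ) ×ˢ (univ : Set (EuclideanSpace ℝ (Fin 3))) :=
      fun y => mk_mem_prod ht (mem_univ y)
    exact hV.comp_continuous (continuous_const.prodMk continuous_id) hmaps
  exact isClosed_eq (irrRotApex_continuous_conjZ_angle hVt x) continuous_const

/-- **An irrational rotation in the stabiliser of a continuous field forces full axisymmetry**: if
`V` is continuous on the open slab and `R_θ V(t, R_{−θ} x) = V(t, x)` there for one `θ` with `θ/2π`
irrational, then the same holds for every angle `φ` (closed subgroup of `ℝ` containing `2π` and
`θ`, `forall_of_irrational_angle_stabiliser`). [folklore] -/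
theorem irrRotApex_stab_all
    {V : ℝ → EuclideanSpace ℝ (Fin 3) → EuclideanSpace ℝ (Fin 3)}
    (hV : ContinuousOn (uncurry V) (Iio (0 : ℝ) ×ˢ (univ : Set (EuclideanSpace ℝ (Fin 3)))))
    {θ : ℝ} (hθ : ∀ t : ℝ, t < 0 → ∀ x : EuclideanSpace ℝ (Fin 3), conjZ θ V t x = V t x)
    (hirr : Irrational (θ / (2 * Real.pi))) :
    ∀ φ : ℝ, ∀ t : ℝ, t < 0 → ∀ x : EuclideanSpace ℝ (Fin 3), conjZ φ V t x = V t x :=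
  forall_of_irrational_angle_stabiliser
    (P := fun φ : ℝ => ∀ t : ℝ, t < 0 → ∀ x : EuclideanSpace ℝ (Fin 3), conjZ φ V t x = V t x)
    (irrRotApex_stab_zero V) (irrRotApex_stab_add V) (irrRotApex_stab_neg V)
    (irrRotApex_stab_isClosed hV) hθ (irrRotApex_stab_two_pi V) hirr

/-! ## The stub -/

/-- AUX-1 `stub_irrationalRotationApexFatal` — **a singular apex profile is not a.e. invariant under
a rotation by an irrational angle**.  For `C ≤ 0` the field vanishes on `t < 0`; for `C > 0` the
continuous (Type-I ancient mild) representative `V` (`stub_apexMildRepresentative`) inherits the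
invariance pointwise on the open slab, its stabiliser is a closed subgroup of `ℝ` containing `θ` and
`2π`, hence `ℝ` when `θ/2π ∉ ℚ`; so `u` is a.e. axisymmetric and
`rellichScar_axisymmetricApexFatal_proof` (Seregin–Šverák 2009) gives the contradiction.
[cite: SereginSverak2009, Thm 3.1 (= Thm 1.1)] -/
theorem stub_irrationalRotationApexFatal : ∀ (u : ℝ → EuclideanSpace ℝ (Fin 3) → EuclideanSpace ℝ (Fin 3)) (p : ℝ → EuclideanSpace ℝ (Fin 3) → ℝ) (G : ℝ → EuclideanSpace ℝ (Fin 3) → EuclideanSpace ℝ (Fin 3) →L[ℝ] EuclideanSpace ℝ (Fin 3)) (C θ : ℝ), Literature.Analysis.FluidPDE.IsSuitableWeakSolutionOn (Literature.Analysis.FluidPDE.slab (EuclideanSpace ℝ (Fin 3)) (Set.Iio 0) isOpen_Iio) 1 0 u p → Literature.Analysis.FluidPDE.HasWeakSpatialGradientOn (Literature.Analysis.FluidPDE.slab (EuclideanSpace ℝ (Fin 3)) (Set.Iio 0) isOpen_Iio) u G → Literature.Analysis.FluidPDE.typeIBound (Set.Iio (0 : ℝ) ×ˢ Set.univ) u p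 G < ⊤ → Literature.Analysis.FluidPDE.HasTypeIDecay C u → Literature.Analysis.FluidPDE.IsBackwardSingularPoint u 0 → Irrational (θ / (2 * Real.pi)) → Function.uncurry (fun t x => Literature.Analysis.FluidPDE.rotZ θ (u t (Literature.Analysis.FluidPDE.rotZ (-θ) x))) =ᵐ[MeasureTheory.volume.restrict (Set.Iio (0 : ℝ) ×ˢ Set.univ)] Function.uncurry u → False := by
  intro u p G C θ hsw hwg hI hdec hsing hirr hrot
  rcases le_or_gt C 0 with hC0 | hC0
  · -- `C ≤ 0`: the field vanishes on the open slab, so the origin is not singular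
    refine not_isBackwardSingularPoint_of_ae_zero_slab (u := u) ?_ hsing
    filter_upwards [ae_restrict_mem (measurableSet_Iio.prod MeasurableSet.univ)] with w hw
    exact eq_zero_of_hasTypeIDecay_nonpos hC0 hdec hw.1 w.2
  · -- `C > 0`: the continuous Type-I ancient mild representative
    obtain ⟨V, hae, hmild, -⟩ := stub_apexMildRepresentative u p G C hC0 hsw hwg hI hdec
    have hcontV :
        ContinuousOn (uncurry V) (Iio (0 : ℝ) ×ˢ (univ : Set (EuclideanSpace ℝ (Fin 3)))) :=
      hmild.1.continuousOn
    -- the a.e. invariance transports to `V` and holds pointwise on the open slab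
    have hrot' : uncurry (conjZ θ u)
        =ᵐ[volume.restrict (Iio (0 : ℝ) ×ˢ (univ : Set (EuclideanSpace ℝ (Fin 3))))] uncurry u :=
      hrot
    have haeV : uncurry (conjZ θ V)
        =ᵐ[volume.restrict (Iio (0 : ℝ) ×ˢ (univ : Set (EuclideanSpace ℝ (Fin 3))))] uncurry V :=
      ((conjZ_ae_eq_slab θ hae).trans hrot').trans hae.symm
    have heqOn : EqOn (uncurry (conjZ θ V)) (uncurry V)
        (Iio (0 : ℝ) ×ˢ (univ : Set (EuclideanSpace ℝ (Fin 3)))) :=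
      Measure.eqOn_open_of_ae_eq haeV (isOpen_Iio.prod isOpen_univ)
        (continuousOn_uncurry_conjZ θ hcontV) hcontV
    have hθ : ∀ t : ℝ, t < 0 → ∀ x : EuclideanSpace ℝ (Fin 3), conjZ θ V t x = V t x :=
      fun t ht x => heqOn (mk_mem_prod ht (mem_univ x))
    -- the stabiliser of `V` is everything
    have hall := irrRotApex_stab_all hcontV hθ hirr
    -- back to `u`: a.e. invariance under every rotation, excluded by `AxisymmetricApexFatal`
    have hA := rellichScar_axisymmetricApexFatal_proof
    unfold AxisymmetricApexFatal at hA
    refine hA u p G C hsw hwg hI hdec hsing fun φ => ?_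
    have h1 : uncurry (conjZ φ u)
        =ᵐ[volume.restrict (Iio (0 : ℝ) ×ˢ (univ : Set (EuclideanSpace ℝ (Fin 3))))]
        uncurry (conjZ φ V) :=
      conjZ_ae_eq_slab φ hae.symm
    have h2 : uncurry (conjZ φ V)
        =ᵐ[volume.restrict (Iio (0 : ℝ) ×ˢ (univ : Set (EuclideanSpace ℝ (Fin 3))))] uncurry V := by
      filter_upwards [ae_restrict_mem (measurableSet_Iio.prod MeasurableSet.univ)] with w hw
      exact hall φ w.1 hw.1 w.2
    exact (h1.trans h2).trans hae

end Summit.NavierStokesRegularity.NavierStokesRegularity.Theorems.SymmetricScarExists.RdssSplit.NearIdentity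

end
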